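import Literature.Combinatorics.SetFamily.SpreadLemmaProofs
import Literature.Computability.Complexity.RossmanMonotoneCliqueClosure
import Literature.Computability.Complexity.NegationElimination
import HarnessLib

/-!
# Quasi-sunflowers, Lemma 9, and the ⋆-closed approximation of a monotone circuit (Rossman 2010, §4–§5)

Two parts.

**Quasi-sunflowers and Lemma 9.** Rossman's `(p, q)`-sunflowers (Definition 5, p. 5: a family `F`
with core `Y ⊆ ⋂ F` such that a `p`-random `W` satisfies
`Pr[W ∪ Y contains no member of F] ≤ q`) are what is nowadays called ROBUST SUNFLOWERS. Instead
of Rossman's Lemma 6 (proved there with Janson's inequality) we extract them from the stronger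
**spread lemma** of Alweiss–Lovett–Wu–Zhang / Rao, which is PROVED in the tree
(`Literature.Combinatorics.SetFamily.spread_lemma_spreadConst`), by the standard
maximal-weight-core argument:

* `exists_quasiSunflower` — an `s`-uniform family `F` (`s ≥ 1`) with
  `|F| > (B log(s/ε)/p)^s` contains a `(p, ε)`-sunflower whose core `Y` is a PROPER subset of a
  member: `Pr_{W ∼ μ_p}[∃ S ∈ F, Y ⊆ S ⊆ Y ∪ W] > 1 - ε` (the replacement for Rossman's Lemma 6,
  with `N^{s(1+ε)}` there becoming `(B log(s/ε)/p)^s` here);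
* `card_minterms_le_of_isClosedFn` — **Lemma 9** (p. 7) in the resulting quantitative form: a
  ⋆-closed monotone `f` (threshold `t`, small vectors `K`, `K` closed under subvectors) has at
  most `(B log(s/t)/p)^s` minterms in `K` with exactly `s ≥ 1` on-coordinates. Proof as printed:
  otherwise the core `h = Y` of a quasi-sunflower of minterms has `Pr[f(G ∪ h) = 0] < t`, so
  `f h = 1` by closedness, contradicting that `h` lies strictly below a minterm.

**The ⋆-closed approximation `C̄`** (§5.2, second part, see its section docstring): along a
straight-line program over `{∧₂, ∨₂}` every wire gets a ⋆-closed monotone approximator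
(`exists_closedApprox`, invariant `StarApproxInv`) with Lemma 13 (error `≤ #gates·|K|·t`) and
Lemma 14 (minterm locality).

## References

* B. Rossman, *The monotone complexity of k-clique on random graphs*, FOCS 2010 (full version
  2009), Definition 5, Lemma 6 (pp. 5–6), Lemma 9 (p. 7), §5.2 with Lemmas 13–14 (p. 8)
  [Rossman2010].
* T. Bell, *The Park–Pham theorem with optimal convergence rate*, Electron. J. Combin. 30 (2023),
  Thm. 3 (the spread lemma as used) [Bell2023].
-/

noncomputable section

namespace Literature.Computability.Complexity

open Finset Literature.Combinatorics.SetFamily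

/-! ### Robust sunflowers from the spread lemma -/

section Sunflower

variable {α : Type*} [Fintype α] [DecidableEq α]

/-- The link of a family at a set `Y`: `{S \ Y : S ∈ F, Y ⊆ S}`. [folklore] -/
def linkFamily (F : Finset (Finset α)) (Y : Finset α) : Finset (Finset α) :=
  (F.filter fun S => Y ⊆ S).image fun S => S \ Y

omit [Fintype α] in
/-- Removing a common subset is injective. [folklore] -/
theorem card_linkFamily (F : Finset (Finset α)) (Y : Finset α) :
    #(linkFamily F Y) = #(F.filter fun S => Y ⊆ S) := by
  refine card_image_of_injOn fun S₁ h₁ S₂ h₂ (h : S₁ \ Y = S₂ \ Y) => ?_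
  simp only [coe_filter, Set.mem_setOf_eq] at h₁ h₂
  rw [← sdiff_union_of_subset h₁.2, ← sdiff_union_of_subset h₂.2, h]

omit [Fintype α] in
/-- Members of the link avoiding `Y`: a superset count in the link is a superset count in `F`.
[folklore] -/
theorem card_filter_linkFamily_le (F : Finset (Finset α)) (Y Z : Finset α) :
    #((linkFamily F Y).filter fun T => Z ⊆ T) ≤ #(F.filter fun S => Y ∪ Z ⊆ S) := by
  calc #((linkFamily F Y).filter fun T => Z ⊆ T)
      ≤ #((F.filter fun S => Y ∪ Z ⊆ S).image fun S => S \ Y) := by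
        refine card_le_card fun T hT => ?_
        simp only [linkFamily, mem_filter, mem_image] at hT ⊢
        obtain ⟨⟨S, ⟨hS, hYS⟩, rfl⟩, hZ⟩ := hT
        exact ⟨S, ⟨hS, union_subset hYS (hZ.trans sdiff_subset)⟩, rfl⟩
    _ ≤ _ := card_image_le

omit [Fintype α] in
/-- A set meeting `Y` is contained in no member of the link at `Y`. [folklore] -/
theorem filter_linkFamily_eq_empty {F : Finset (Finset α)} {Y Z : Finset α} (h : ¬ Disjoint Z Y) :
    ((linkFamily F Y).filter fun T => Z ⊆ T) = ∅ := by
  refine filter_false_of_mem fun T hT hZT => h ?_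
  simp only [linkFamily, mem_image, mem_filter] at hT
  obtain ⟨S, -, rfl⟩ := hT
  exact disjoint_of_subset_left hZT disjoint_sdiff_self_left

/-- **Robust (quasi-)sunflowers in large uniform families** (replacing Rossman 2010, Lemma 6, via
the spread lemma): if `F` is `s`-uniform, `s ≥ 1`, `0 < p ≤ 1/2`, `0 < ε ≤ 1/2` and
`|F| > (B log(s/ε)/p)^s` (`B = spreadConst`), then there is a core `Y`, a proper subset of some
member of `F`, such that `Pr_{W ∼ μ_p}[∃ S ∈ F, Y ⊆ S ⊆ Y ∪ W] > 1 - ε` — i.e. the members of `F`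
through `Y` form a `(p, ε)`-sunflower over `Y` in the sense of Rossman's Definition 5.
[cite: Rossman2010, Definition 5 and Lemma 6 (p. 5)] -/
theorem exists_quasiSunflower (F : Finset (Finset α)) {s : ℕ} (hs : 1 ≤ s) {p ε : ℝ}
    (hp0 : 0 < p) (hp1 : p ≤ 1 / 2) (hε0 : 0 < ε) (hε1 : ε ≤ 1 / 2) (hunif : ∀ S ∈ F, #S = s)
    (hbig : (spreadConst * Real.log (s / ε) / p) ^ s < #F) :
    ∃ Y : Finset α, (∃ S ∈ F, Y ⊂ S) ∧
      1 - ε < ∑ W ∈ univ.filter (fun W : Finset α => ∃ S ∈ F, Y ⊆ S ∧ S ⊆ Y ∪ W),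
        biasedWeight p W := by
  set r : ℝ := spreadConst * Real.log (s / ε) / p with hr
  have hlog : 0 < Real.log (s / ε) := by
    refine Real.log_pos ?_
    rw [lt_div_iff₀ hε0]
    have : (1 : ℝ) ≤ s := by exact_mod_cast hs
    linarith
  have hr0 : 0 < r := by rw [hr]; exact div_pos (mul_pos spreadConst_pos hlog) hp0
  -- the weight to maximise
  set Φ : Finset α → ℝ := fun Y => #(F.filter fun S => Y ⊆ S) * r ^ #Y with hΦ
  obtain ⟨Y, -, hY⟩ := exists_max_image (univ : Finset (Finset α)) Φ univ_nonempty
  have hΦ0 : Φ ∅ = #F := by simp [hΦ]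
  have hYF : (#F : ℝ) ≤ Φ Y := hΦ0 ▸ hY ∅ (mem_univ _)
  set FY := F.filter fun S => Y ⊆ S with hFY
  have hrs : 0 < r ^ s := pow_pos hr0 s
  have hFY0 : FY.Nonempty := by
    rw [← card_pos]
    by_contra h0
    push Not at h0
    have : #FY = 0 := Nat.le_zero.1 h0
    have h1 : Φ Y = 0 := by simp [hΦ, ← hFY, this]
    rw [h1] at hYF
    have : (0 : ℝ) < #F := hrs.trans hbig
    linarith
  -- the core is a proper subset of every member through it
  have hproper : ∀ S ∈ FY, Y ⊂ S := by
    intro S hS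
    rw [hFY, mem_filter] at hS
    refine lt_of_le_of_ne hS.2 fun hYS => ?_
    subst hYS
    have hsub : FY ⊆ {Y} := by
      intro S' hS'
      rw [hFY, mem_filter] at hS'
      rw [mem_singleton]
      exact (eq_of_subset_of_card_le hS'.2 (by rw [hunif _ hS'.1, hunif _ hS.1])).symm
    have h1 : (#FY : ℝ) ≤ 1 := by exact_mod_cast (card_le_card hsub).trans (card_singleton _).le
    have h2 : Φ Y ≤ r ^ s := by
      simp only [hΦ, ← hFY, hunif _ hS.1]
      nlinarith
    linarith
  -- the link family is spread
  have hsp : IsSpread r (linkFamily F Y) := by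
    intro Z
    rw [card_linkFamily, ← hFY]
    by_cases hZY : Disjoint Z Y
    · have hmax := hY (Y ∪ Z) (mem_univ _)
      simp only [hΦ, ← hFY] at hmax
      rw [card_union_of_disjoint hZY.symm, pow_add] at hmax
      rw [le_div_iff₀ (pow_pos hr0 _)]
      have hcZ : (#((linkFamily F Y).filter fun T => Z ⊆ T) : ℝ) ≤ #(F.filter fun S => Y ∪ Z ⊆ S) := by
        exact_mod_cast card_filter_linkFamily_le F Y Z
      calc (#((linkFamily F Y).filter fun T => Z ⊆ T) : ℝ) * r ^ #Z
          ≤ #(F.filter fun S => Y ∪ Z ⊆ S) * r ^ #Z :=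
            mul_le_mul_of_nonneg_right hcZ (pow_nonneg hr0.le _)
        _ ≤ #FY := by
            have := mul_le_mul_of_nonneg_right hmax (le_of_lt (inv_pos.2 (pow_pos hr0 #Y)))
            field_simp at this
            nlinarith [this, pow_pos hr0 #Y]
    · rw [filter_linkFamily_eq_empty hZY, card_empty, Nat.cast_zero]
      positivity
  have hne : (linkFamily F Y).Nonempty := by
    rw [← card_pos, card_linkFamily, ← hFY, card_pos]; exact hFY0
  have hbdd : ∀ T ∈ linkFamily F Y, #T ≤ s := by
    intro T hT
    simp only [linkFamily, mem_image, mem_filter] at hT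
    obtain ⟨S, ⟨hS, -⟩, rfl⟩ := hT
    exact (card_le_card sdiff_subset).trans (hunif S hS).le
  have key := spread_lemma_spreadConst (linkFamily F Y) s p ε hs hp0 hp1 hε0 hε1 hne hbdd hsp
  obtain ⟨S₀, hS₀⟩ := hFY0
  refine ⟨Y, ⟨S₀, (mem_filter.1 hS₀).1, hproper S₀ hS₀⟩, key.trans_le (le_of_eq ?_)⟩
  refine sum_congr (filter_congr fun W _ => ?_) fun _ _ => rfl
  simp only [linkFamily, mem_image, mem_filter]
  constructor
  · rintro ⟨T, ⟨S, ⟨hS, hYS⟩, rfl⟩, hTW⟩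
    exact ⟨S, hS, hYS, by simpa [sdiff_le_iff] using hTW⟩
  · rintro ⟨S, hS, hYS, hSW⟩
    exact ⟨S \ Y, ⟨S, ⟨hS, hYS⟩, rfl⟩, by simpa [sdiff_le_iff] using hSW⟩

end Sunflower

/-! ### Lemma 9: ⋆-closed functions have few small minterms -/

section Lemma9

variable {ι : Type*} [Fintype ι] [DecidableEq ι]

omit [DecidableEq ι] in
/-- Strict order of vectors is strict inclusion of supports. [folklore] -/
theorem lt_iff_onSet_ssubset (x y : ι → Bool) : x < y ↔ onSet x ⊂ onSet y := by
  simp only [lt_iff_le_and_ne, le_iff_onSet_subset, ne_eq, onSet_inj]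

/-- **Lemma 9** (Rossman 2010, p. 7, "⋆-closed functions have few minterms in `I ∪ J`"), in the
quantitative form given by the spread lemma: let `f` be monotone and ⋆-closed for bias
`0 < p ≤ 1/2`, threshold `0 < t ≤ 1/2` and a set `K` of small vectors closed under subvectors.
Then any set `M ⊆ K` of minterms of `f` with exactly `s ≥ 1` on-coordinates each has
`|M| ≤ (B log(s/t)/p)^s`. (Printed: `< o(n^{s(2/(k-1)+2δ)})` for `p = n^{-2(1+δ)/(k-1)}`,
`t = e^{-n^δ}`.) [cite: Rossman2010, Lemma 9 (p. 7)] -/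
theorem card_minterms_le_of_isClosedFn {p t : ℝ} (hp0 : 0 < p) (hp1 : p ≤ 1 / 2) (ht0 : 0 < t)
    (ht1 : t ≤ 1 / 2) {K : Finset (ι → Bool)} (hK : ∀ x ∈ K, ∀ y, y ≤ x → y ∈ K)
    {f : (ι → Bool) → Bool} (hf : Monotone f) (hc : IsClosedFn p t K f) {s : ℕ} (hs : 1 ≤ s)
    (M : Finset (ι → Bool)) (hM : ∀ m ∈ M, m ∈ K ∧ IsMinterm f m ∧ #(onSet m) = s) :
    (#M : ℝ) ≤ (spreadConst * Real.log (s / t) / p) ^ s := by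
  by_contra hlt
  rw [not_le] at hlt
  have hp1' : p ≤ 1 := hp1.trans (by norm_num)
  set F : Finset (Finset ι) := M.image onSet with hF
  have hcard : #F = #M := card_image_of_injective _ onSet_injective
  have hunif : ∀ S ∈ F, #S = s := by
    intro S hS
    obtain ⟨m, hm, rfl⟩ := mem_image.1 hS
    exact (hM m hm).2.2
  obtain ⟨Y, ⟨S₁, hS₁, hYS₁⟩, hprob⟩ :=
    exists_quasiSunflower F hs hp0 hp1 ht0 ht1 hunif (by rw [hcard]; exact hlt)
  obtain ⟨m₁, hm₁, rfl⟩ := mem_image.1 hS₁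
  -- the core, as a vector, lies strictly below the minterm `m₁`
  set h : ι → Bool := indVec Y with hh
  have hlt₁ : h < m₁ := by rw [lt_iff_onSet_ssubset, hh, onSet_indVec]; exact hYS₁
  have hhK : h ∈ K := hK m₁ (hM m₁ hm₁).1 h hlt₁.le
  have hfh : f h = false := (hM m₁ hm₁).2.1.eq_false_of_lt hlt₁
  -- but `f (G ∪ h) = 1` with probability `> 1 - t`
  have hfails : fails p f h < t := by
    have e1 : fails p f h = 1 - prob p (fun x => f (x ⊔ h) = true) := by
      rw [fails, ← prob_not]
      exact prob_congr fun x => by simp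
    have e2 : prob p (fun x => ∃ S ∈ F, Y ⊆ S ∧ S ⊆ Y ∪ onSet x)
        ≤ prob p (fun x => f (x ⊔ h) = true) := by
      refine prob_mono hp0.le hp1' fun x ⟨S, hS, _, hSW⟩ => ?_
      obtain ⟨m, hm, rfl⟩ := mem_image.1 hS
      refine eq_true_of_monotone_le hf ((le_iff_onSet_subset m _).2 ?_) (hM m hm).2.1.eq_true
      rw [onSet_sup, hh, onSet_indVec, union_comm]
      exact hSW
    have e3 := prob_comp_onSet p (fun W => ∃ S ∈ F, Y ⊆ S ∧ S ⊆ Y ∪ W)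
    rw [e1]
    linarith
  have := hc h hhK hfails.le
  rw [hfh] at this
  exact Bool.noConfusion this

end Lemma9

end Literature.Computability.Complexity

/-!
## The ⋆-closed approximation of a monotone circuit (Rossman 2010, §5.2)

Given a straight-line program over the fan-in-2 monotone basis `{∧₂, ∨₂}` (`GateList` calculus of
`CircuitComposition.lean` / `NegationElimination.lean`), Rossman's *⋆-closed approximation*
`C̄` replaces every `∨`-gate by `∨̄ : (f, g) ↦ (f ∨ g)⋆` (the ⋆-closure of
`RossmanMonotoneCliqueClosure.lean`) and keeps `∧`-gates (§5.2, p. 8). We construct, by induction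
along the program, an approximating function `ap w` for every wire `w` and prove simultaneously
(`exists_closedApprox`):

* every `ap w` is monotone and ⋆-closed (conjunctions of closed functions are closed, inputs are
  closed for `t < 1 - p`);
* `C ≤ C̄` wire by wire (`dom`);
* **Lemma 13** (p. 8, at `H = ∅`): `Pr_{G ∼ μ_p}[some gate of C disagrees with C̄] ≤ #gates·|K|·t`
  (`err`, from Lemma 11 gate by gate and a union bound);
* **Lemma 14** (p. 8): for every vector `H₀`, if no gate of `C̄` has a minterm below `H₀` lying
  in `J`, then every minterm below `H₀` of every wire of `C̄` lies in `I` (`loc`; induction on the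
  program using Observation 7 and Lemma 12).

Here `I`, `J` are abstract finite sets of vectors with `Ind_{single i} ∈ I` and
`I ⊔ I ⊆ I ∪ J`; the closure is taken with respect to `K = I ∪ J`.

## References

* B. Rossman, *The monotone complexity of k-clique on random graphs*, FOCS 2010 (full version
  2009), §5.2, Lemmas 13 and 14, p. 8 [Rossman2010].
-/

noncomputable section

namespace Literature.Computability.Complexity

open Finset GateList

variable {ι : Type*} [Fintype ι] [DecidableEq ι]

/-- The invariant of the ⋆-closed approximation `ap` of the wires of the program `gs`
(Rossman 2010, §5.2): input wires are approximated by themselves; every valid wire's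
approximator is monotone, ⋆-closed (w.r.t. `K = I ∪ J`) and dominates the wire; the gates
disagree with their approximators only on an event of probability `≤ #gates · |K| · t`
(Lemma 13); and minterm locality (Lemma 14). [cite: Rossman2010, §5.2 (p. 8)] -/
structure StarApproxInv (p t : ℝ) (I J : Finset (ι → Bool)) (gs : List (Gate ι))
    (ap : ι ⊕ ℕ → (ι → Bool) → Bool) : Prop where
  /-- input wires are approximated exactly -/
  inl : ∀ i, ap (.inl i) = fun x => x i
  /-- approximators are monotone -/
  mono : ∀ w, OutOK gs.length w → Monotone (ap w)
  /-- approximators are ⋆-closed -/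
  closed : ∀ w, OutOK gs.length w → IsClosedFn p t (I ∪ J) (ap w)
  /-- `C ≤ C̄` wire by wire -/
  dom : ∀ w, OutOK gs.length w → ∀ x, wireOf x (vals gs x) w = true → ap w x = true
  /-- Lemma 13: the gates rarely disagree with their approximators -/
  err : prob p (fun x => ∃ m < gs.length, (vals gs x).getD m false ≠ ap (.inr m) x)
    ≤ gs.length * (#(I ∪ J) * t)
  /-- Lemma 14: minterm locality -/
  loc : ∀ H₀ : ι → Bool, (∀ m < gs.length, ∀ H, IsMinterm (ap (.inr m)) H → H ≤ H₀ → H ∉ J) →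
    ∀ w, OutOK gs.length w → ∀ H, IsMinterm (ap w) H → H ≤ H₀ → H ∈ I

namespace StarApproxInv

variable {p t : ℝ} {I J : Finset (ι → Bool)} {gs : List (Gate ι)} {ap : ι ⊕ ℕ → (ι → Bool) → Bool}

/-- Off the exceptional event, every valid wire agrees with its approximator. [folklore] -/
theorem agree (h : StarApproxInv p t I J gs ap) {x : ι → Bool}
    (hx : ¬ ∃ m < gs.length, (vals gs x).getD m false ≠ ap (.inr m) x) :
    ∀ w, OutOK gs.length w → wireOf x (vals gs x) w = ap w x := by
  rintro (i | m) hw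
  · rw [h.inl i]; rfl
  · have hm := hw m rfl
    by_contra hne
    exact hx ⟨m, hm, hne⟩

/-- The empty program: only input wires, approximated by themselves. [folklore] -/
theorem nil (htp : t < 1 - p) (hI1 : ∀ i, indVec {i} ∈ I) :
    StarApproxInv p t I J ([] : List (Gate ι))
      (fun w => match w with | .inl i => fun x => x i | .inr _ => fun _ => true) where
  inl _ := rfl
  mono w _ := by
    rcases w with i | m
    · exact monotone_apply_bool i
    · exact monotone_const
  closed w _ := by
    rcases w with i | m
    · exact isClosedFn_apply htp _ i
    · exact isClosedFn_const_true p t _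
  dom w hw x hx := by
    rcases w with i | m
    · exact hx
    · rfl
  err := by
    refine le_of_eq (((prob_congr fun x => ?_).trans (prob_false p)).trans (by simp))
    simp
  loc H₀ _ w hw H hH _ := by
    rcases w with i | m
    · rw [(isMinterm_apply_iff i H).1 hH]; exact hI1 i
    · exact absurd (hw m rfl) (by simp)

end StarApproxInv

section Step

variable {p t : ℝ} {I J : Finset (ι → Bool)} {gs : List (Gate ι)}
  {ap : ι ⊕ ℕ → (ι → Bool) → Bool}

omit [Fintype ι] [DecidableEq ι] in
/-- Old gate values are unchanged by appending a gate. [folklore] -/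
theorem getD_vals_append_singleton_of_lt (gs : List (Gate ι)) (g : Gate ι) (x : ι → Bool) {m : ℕ}
    (hm : m < gs.length) :
    (vals (gs ++ [g]) x).getD m false = (vals gs x).getD m false := by
  have := wireOf_vals_append gs [g] x (.inr m) (fun m' h => by cases h; exact hm)
  simpa using this

/-- **The induction step** of the ⋆-closed approximation: appending one monotone gate `g`
reading valid wires `u, v`, approximated by a new function `nw` which is monotone, ⋆-closed,
dominates `ap u ⋄ ap v`, differs from it with probability `≤ |K| t`, and whose minterms are
unions of minterms of `ap u`, `ap v` or lie in `I ∪ J` (`⋄ = ∧` exactly, or `⋄ = ∨` followed by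
⋆-closure). [cite: Rossman2010, §5.2 (p. 8)] -/
theorem StarApproxInv.snoc (h : StarApproxInv p t I J gs ap) (hp0 : 0 ≤ p) (hp1 : p ≤ 1)
    (g : Gate ι) (u v : ι ⊕ ℕ) (hu : OutOK gs.length u)
    (hv : OutOK gs.length v) (op : Bool → Bool → Bool)
    (hop : ∀ x, (vals (gs ++ [g]) x).getD gs.length false =
      op (wireOf x (vals gs x) u) (wireOf x (vals gs x) v))
    (nw : (ι → Bool) → Bool) (hmono : Monotone nw) (hclosed : IsClosedFn p t (I ∪ J) nw)
    (hdom : ∀ x, op (ap u x) (ap v x) = true → nw x = true)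
    (hopm : ∀ a b a' b', a ≤ a' → b ≤ b' → op a b ≤ op a' b')
    (herr : prob p (fun x => op (ap u x) (ap v x) ≠ nw x) ≤ #(I ∪ J) * t)
    (hloc : ∀ H₀ : ι → Bool, (∀ H, IsMinterm (ap u) H → H ≤ H₀ → H ∈ I) →
      (∀ H, IsMinterm (ap v) H → H ≤ H₀ → H ∈ I) →
      ∀ H, IsMinterm nw H → H ≤ H₀ → H ∈ I ∪ J) :
    StarApproxInv p t I J (gs ++ [g]) (fun w => if w = .inr gs.length then nw else ap w) := by
  have hlen : (gs ++ [g]).length = gs.length + 1 := by simp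
  -- validity of old wires
  have hold : ∀ w : ι ⊕ ℕ, OutOK (gs ++ [g]).length w → w ≠ .inr gs.length → OutOK gs.length w := by
    intro w hw hne m hm
    subst hm
    have h1 := hw m rfl
    rw [hlen] at h1
    have : m ≠ gs.length := fun h => hne (by rw [h])
    omega
  have hwire : ∀ w : ι ⊕ ℕ, OutOK gs.length w → ∀ x,
      wireOf x (vals (gs ++ [g]) x) w = wireOf x (vals gs x) w := fun w hw x =>
    wireOf_vals_append gs [g] x w hw
  constructor
  · intro i
    rw [if_neg (by simp)]
    exact h.inl i
  · intro w hw
    by_cases hwn : w = .inr gs.length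
    · subst hwn; simpa using hmono
    · rw [if_neg hwn]; exact h.mono w (hold w hw hwn)
  · intro w hw
    by_cases hwn : w = .inr gs.length
    · subst hwn; simpa using hclosed
    · rw [if_neg hwn]; exact h.closed w (hold w hw hwn)
  · intro w hw x hx
    by_cases hwn : w = .inr gs.length
    · subst hwn
      simp only [↓reduceIte]
      rw [wireOf_inr, hop] at hx
      refine hdom x ?_
      have h1 := hopm _ _ _ _ (Bool.le_iff_imp.2 (h.dom u hu x)) (Bool.le_iff_imp.2 (h.dom v hv x))
      rw [hx] at h1
      exact top_le_iff.1 h1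
    · rw [if_neg hwn]
      rw [hwire w (hold w hw hwn)] at hx
      exact h.dom w (hold w hw hwn) x hx
  · -- Lemma 13: union bound
    have hsub : ∀ x, (∃ m < (gs ++ [g]).length, (vals (gs ++ [g]) x).getD m false ≠
          (if (Sum.inr m : ι ⊕ ℕ) = .inr gs.length then nw else ap (.inr m)) x) →
        (∃ m < gs.length, (vals gs x).getD m false ≠ ap (.inr m) x) ∨
          op (ap u x) (ap v x) ≠ nw x := by
      rintro x ⟨m, hm, hne⟩
      rw [hlen] at hm
      by_cases hmeq : m = gs.length
      · subst hmeq
        simp only [↓reduceIte] at hne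
        by_cases hbad : ∃ m < gs.length, (vals gs x).getD m false ≠ ap (.inr m) x
        · exact Or.inl hbad
        · right
          rw [hop, h.agree hbad u hu, h.agree hbad v hv] at hne
          exact hne
      · left
        have hm' : m < gs.length := by omega
        refine ⟨m, hm', ?_⟩
        rw [if_neg (by simpa using hmeq), getD_vals_append_singleton_of_lt gs g x hm'] at hne
        exact hne
    calc prob p (fun x => ∃ m < (gs ++ [g]).length, (vals (gs ++ [g]) x).getD m false ≠
            (if (Sum.inr m : ι ⊕ ℕ) = .inr gs.length then nw else ap (.inr m)) x)
        ≤ prob p (fun x => (∃ m < gs.length, (vals gs x).getD m false ≠ ap (.inr m) x) ∨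
            op (ap u x) (ap v x) ≠ nw x) := prob_mono hp0 hp1 hsub
      _ ≤ gs.length * (#(I ∪ J) * t) + #(I ∪ J) * t := (prob_or_le hp0 hp1 _ _).trans (add_le_add h.err herr)
      _ = (gs ++ [g]).length * (#(I ∪ J) * t) := by rw [hlen]; push_cast; ring
  · -- Lemma 14
    intro H₀ hyp w hw H hH hle
    have hyp_old : ∀ m < gs.length, ∀ H, IsMinterm (ap (.inr m)) H → H ≤ H₀ → H ∉ J := by
      intro m hm H' hH' hle'
      have := hyp m (by rw [hlen]; omega) H'
      rw [if_neg (by simp; omega)] at this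
      exact this hH' hle'
    have ihloc := h.loc H₀ hyp_old
    by_cases hwn : w = .inr gs.length
    · subst hwn
      simp only [↓reduceIte] at hH
      have hnotJ : H ∉ J := by
        have := hyp gs.length (by rw [hlen]; omega) H
        simp only [↓reduceIte] at this
        exact this hH hle
      have := hloc H₀ (ihloc u hu) (ihloc v hv) H hH hle
      rw [mem_union] at this
      exact this.resolve_right hnotJ
    · rw [if_neg hwn] at hH
      exact ihloc w (hold w hw hwn) H hH hle

end Step

/-- **The ⋆-closed approximation of a monotone program** (Rossman 2010, §5.2 with Lemmas 13 and
14): for `0 ≤ p ≤ 1`, `0 ≤ t < 1 - p`, finite sets `I, J` of vectors with all single-coordinate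
vectors in `I` and `I ⊔ I ⊆ I ∪ J`, every well-formed program over `{∧₂, ∨₂}` admits wire
approximators satisfying `StarApproxInv` (closed, monotone, dominating, Lemma 13 error bound
`≤ #gates · |I ∪ J| · t`, Lemma 14 minterm locality). [cite: Rossman2010, Lemmas 13–14 (p. 8)] -/
theorem exists_closedApprox {p t : ℝ} (hp0 : 0 ≤ p) (hp1 : p ≤ 1) (ht : 0 ≤ t) (htp : t < 1 - p)
    {I J : Finset (ι → Bool)} (hI1 : ∀ i, indVec {i} ∈ I)
    (hIJ : ∀ x ∈ I, ∀ y ∈ I, x ⊔ y ∈ I ∪ J) :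
    ∀ gs : List (Gate ι), WF gs → (∀ g ∈ gs, g.fn ∈ monotoneBasis) →
      ∃ ap : ι ⊕ ℕ → (ι → Bool) → Bool, StarApproxInv p t I J gs ap := by
  intro gs
  induction gs using List.reverseRecOn with
  | nil => exact fun _ _ => ⟨_, StarApproxInv.nil htp hI1⟩
  | append_singleton gs g ih =>
    intro hwf hB
    obtain ⟨ap, hap⟩ := ih hwf.of_append_left fun g' hg' => hB g' (List.mem_append_left _ hg')
    have hgOK : GateOK gs.length g := hwf.gateOK_mid (post := [])
    have hgB : g.fn ∈ monotoneBasis := hB g (by simp)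
    have hnew : ∀ x, (vals (gs ++ [g]) x).getD gs.length false =
        g.op (fun a => wireOf x (vals gs x) (g.args a)) := fun x =>
      getD_vals_append_cons gs g [] x
    simp only [monotoneBasis, Set.mem_insert_iff, Set.mem_singleton_iff] at hgB
    rcases hgB with hc | hc
    · -- AND gate: exact conjunction of the approximators
      obtain ⟨u, v, rfl⟩ := exists_eq_andGate_of_fn_eq hc
      have hu : OutOK gs.length u := fun n hn => hgOK (0 : Fin 2) n hn
      have hv : OutOK gs.length v := fun n hn => hgOK (1 : Fin 2) n hn
      refine ⟨_, hap.snoc hp0 hp1 _ u v hu hv (fun a b => a && b)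
        (fun x => by rw [hnew, andGate_op]) (fun x => ap u x && ap v x)
        (monotone_band (hap.mono u hu) (hap.mono v hv))
        ((hap.closed u hu).band hp0 hp1 (hap.closed v hv)) (fun x hx => hx)
        (fun a b a' b' h1 h2 => ?_) ?_ ?_⟩
      · rw [Bool.le_iff_imp] at h1 h2 ⊢; simp only [Bool.and_eq_true]; tauto
      · refine le_trans (le_of_eq ((prob_congr fun x => by simp).trans (prob_false p))) ?_
        exact mul_nonneg (Nat.cast_nonneg _) ht
      · intro H₀ hU hV H hH hle
        obtain ⟨m₁, m₂, hm₁, hm₂, h1, h2, rfl⟩ := hH.of_and (hap.mono u hu) (hap.mono v hv)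
        exact hIJ _ (hU m₁ hm₁ (h1.trans hle)) _ (hV m₂ hm₂ (h2.trans hle))
    · -- OR gate: ⋆-closure of the disjunction
      obtain ⟨u, v, rfl⟩ := exists_eq_orGate_of_fn_eq hc
      have hu : OutOK gs.length u := fun n hn => hgOK (0 : Fin 2) n hn
      have hv : OutOK gs.length v := fun n hn => hgOK (1 : Fin 2) n hn
      have hmuv : Monotone fun x => ap u x || ap v x := monotone_bor (hap.mono u hu) (hap.mono v hv)
      refine ⟨_, hap.snoc hp0 hp1 _ u v hu hv (fun a b => a || b)
        (fun x => by rw [hnew, orGate_op]) (starClosure p t (I ∪ J) fun x => ap u x || ap v x)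
        (monotone_starClosure p t _ hmuv) (isClosedFn_starClosure p t _ hmuv) (fun x hx => ?_)
        (fun a b a' b' h1 h2 => ?_) (prob_ne_starClosure_le hp0 hp1 ht _ hmuv) ?_⟩
      · have := le_starClosure p t (I ∪ J) (fun x => ap u x || ap v x) x
        rw [Bool.le_iff_imp] at this
        exact this hx
      · rw [Bool.le_iff_imp] at h1 h2 ⊢; simp only [Bool.or_eq_true]; tauto
      · intro H₀ hU hV H hH hle
        rcases hH.of_starClosure with hH | hH
        · rcases hH.of_or with hH | hH
          · exact mem_union_left _ (hU H hH hle)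
          · exact mem_union_left _ (hV H hH hle)
        · exact hH

end Literature.Computability.Complexity
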